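import Literature.NumberTheory.EllipticCurves.PointCountEulerCriterion
import HarnessLib

/-!
# BSD rank-≤1 residual cell, class X11 ∧ r = 1 ∧ ¬sst ∧ p ≥ 5: Frobenius point-count certificates
# `#Ẽ(𝔽_ℓ) = n` for the 85 record models (part 2 of 2; kernel-decided data)

HONEST FRAMING (cell `b2b-bsdres-*`, verbatim): prove what is provable now; shrink each hard class
to its core with data; no claim beyond stated classes; COMBINATION classes deleted from PUBLISHED
theorems only, CONSTRUCTION-shaped remainder typed; this is not "finishing BSD".

Theorems only (kernel-decided data: no definition, no named fact, no `native_decide`), in the exact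
shape of the tree's `RationalIsogenyFrobeniusCertificates*.lean` (`card_<E>_<ℓ>`): for each record
`r` of `X11RankOneCertificates.records{1,2}` (unit `b2b-bsdres-x11c`; Cremona label in the theorem
name, a-invariants literal) and ONE odd prime `ℓ` of good reduction (`ℓ ∤ Δ`, `ℓ ≠ p`, the smallest
one for which `X² − a_ℓX + ℓ` has no root modulo the record's prime `p`), the point count
`#Ẽ(𝔽_ℓ) = n` of the reduction of the record's integer model, on `E.map (Int.castRingHom (ZMod ℓ))`
— the shape of `WeierstrassCurve.reductionPointCount` —, decided by the kernel through
`WeierstrassCurve.natCard_point_eq_one_add_card` and `card_sol_eq_sum_euler` (Euler's criterion,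
column by column). Consumer: `Rank1ResidualX11RankOneReduction.lean`, where `a_ℓ = ℓ + 1 − n` and
the root-freeness of `X² − a_ℓX + ℓ (mod p)` (decided there) give `E[p]` irreducible by Mazur 1978
Prop. 6.3 (1) (`IntModel.hasIrreducibleModPGaloisRep_of_intModel_of_noroot`). The witnesses were
found by the seat's script `work/gen/compute_certs.py` (naive count); the kernel RE-VERIFIES every
count here, which is the only thing these theorems rely on.

References: B. Mazur, Invent. Math. 44 (1978) Prop. 6.3 (1) [Mazur1978]; K. Ireland, M. Rosen, GTM 84
(1990) Prop. 5.1.2, §8.1 [IrelandRosen1990]; J. E. Cremona, *Algorithms for Modular Elliptic Curves*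
(1997), Table 1 (labels) [CremonaAlgorithms1997].
-/

set_option linter.dupNamespace false

namespace Summit.BirchSwinnertonDyer.BirchSwinnertonDyer.Rank1Residual.X11RankOne

open Literature.NumberTheory.EllipticCurves

/-- `#Ẽ(𝔽_7) = 4` (`a_7 = 4`; `X² − a_7X + 7` root-free mod `p = 5`) for record `14520l1`. [folklore] -/
theorem card_c14520l1_7 :
    Nat.card (((⟨0, -1, 0, 9365360, 18176452285⟩ : WeierstrassCurve ℤ).map (Int.castRingHom (ZMod 7))).toAffine.Point) = 4 := by
  rw [@WeierstrassCurve.natCard_point_eq_one_add_card (ZMod 7) (@ZMod.instField 7 ⟨by norm_num⟩) _ _ _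
    (by decide +kernel), @card_sol_eq_sum_euler (ZMod 7) (@ZMod.instField 7 ⟨by norm_num⟩) _ _
    (by rw [ZMod.ringChar_zmod_n]; decide), ZMod.card]
  decide +kernel

/-- `#Ẽ(𝔽_3) = 6` (`a_3 = -2`; `X² − a_3X + 3` root-free mod `p = 5`) for record `14560d1`. [folklore] -/
theorem card_c14560d1_3 :
    Nat.card (((⟨0, 1, 0, -630026, 192068320⟩ : WeierstrassCurve ℤ).map (Int.castRingHom (ZMod 3))).toAffine.Point) = 6 := by
  rw [@WeierstrassCurve.natCard_point_eq_one_add_card (ZMod 3) (@ZMod.instField 3 ⟨by norm_num⟩) _ _ _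
    (by decide +kernel), @card_sol_eq_sum_euler (ZMod 3) (@ZMod.instField 3 ⟨by norm_num⟩) _ _
    (by rw [ZMod.ringChar_zmod_n]; decide), ZMod.card]
  decide +kernel

/-- `#Ẽ(𝔽_7) = 8` (`a_7 = 0`; `X² − a_7X + 7` root-free mod `p = 5`) for record `15030p1`. [folklore] -/
theorem card_c15030p1_7 :
    Nat.card (((⟨1, -1, 1, -347, 30219⟩ : WeierstrassCurve ℤ).map (Int.castRingHom (ZMod 7))).toAffine.Point) = 8 := by
  rw [@WeierstrassCurve.natCard_point_eq_one_add_card (ZMod 7) (@ZMod.instField 7 ⟨by norm_num⟩) _ _ _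
    (by decide +kernel), @card_sol_eq_sum_euler (ZMod 7) (@ZMod.instField 7 ⟨by norm_num⟩) _ _
    (by rw [ZMod.ringChar_zmod_n]; decide), ZMod.card]
  decide +kernel

/-- `#Ẽ(𝔽_11) = 11` (`a_11 = 1`; `X² − a_11X + 11` root-free mod `p = 5`) for record `15190bi1`. [folklore] -/
theorem card_c15190bi1_11 :
    Nat.card (((⟨1, 0, 0, -260, -400⟩ : WeierstrassCurve ℤ).map (Int.castRingHom (ZMod 11))).toAffine.Point) = 11 := by
  rw [@WeierstrassCurve.natCard_point_eq_one_add_card (ZMod 11) (@ZMod.instField 11 ⟨by norm_num⟩) _ _ _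
    (by decide +kernel), @card_sol_eq_sum_euler (ZMod 11) (@ZMod.instField 11 ⟨by norm_num⟩) _ _
    (by rw [ZMod.ringChar_zmod_n]; decide), ZMod.card]
  decide +kernel

/-- `#Ẽ(𝔽_3) = 7` (`a_3 = -3`; `X² − a_3X + 3` root-free mod `p = 5`) for record `15190k1`. [folklore] -/
theorem card_c15190k1_3 :
    Nat.card (((⟨1, -1, 0, -6085, -179915⟩ : WeierstrassCurve ℤ).map (Int.castRingHom (ZMod 3))).toAffine.Point) = 7 := by
  rw [@WeierstrassCurve.natCard_point_eq_one_add_card (ZMod 3) (@ZMod.instField 3 ⟨by norm_num⟩) _ _ _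
    (by decide +kernel), @card_sol_eq_sum_euler (ZMod 3) (@ZMod.instField 3 ⟨by norm_num⟩) _ _
    (by rw [ZMod.ringChar_zmod_n]; decide), ZMod.card]
  decide +kernel

/-- `#Ẽ(𝔽_19) = 22` (`a_19 = -2`; `X² − a_19X + 19` root-free mod `p = 5`) for record `15210bi1`. [folklore] -/
theorem card_c15210bi1_19 :
    Nat.card (((⟨1, -1, 1, 60747187, -76210319883⟩ : WeierstrassCurve ℤ).map (Int.castRingHom (ZMod 19))).toAffine.Point) = 22 := by
  rw [@WeierstrassCurve.natCard_point_eq_one_add_card (ZMod 19) (@ZMod.instField 19 ⟨by norm_num⟩) _ _ _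
    (by decide +kernel), @card_sol_eq_sum_euler (ZMod 19) (@ZMod.instField 19 ⟨by norm_num⟩) _ _
    (by rw [ZMod.ringChar_zmod_n]; decide), ZMod.card]
  decide +kernel

/-- `#Ẽ(𝔽_7) = 9` (`a_7 = -1`; `X² − a_7X + 7` root-free mod `p = 5`) for record `15390b1`. [folklore] -/
theorem card_c15390b1_7 :
    Nat.card (((⟨1, -1, 0, -7710, 464516⟩ : WeierstrassCurve ℤ).map (Int.castRingHom (ZMod 7))).toAffine.Point) = 9 := by
  rw [@WeierstrassCurve.natCard_point_eq_one_add_card (ZMod 7) (@ZMod.instField 7 ⟨by norm_num⟩) _ _ _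
    (by decide +kernel), @card_sol_eq_sum_euler (ZMod 7) (@ZMod.instField 7 ⟨by norm_num⟩) _ _
    (by rw [ZMod.ringChar_zmod_n]; decide), ZMod.card]
  decide +kernel

/-- `#Ẽ(𝔽_7) = 13` (`a_7 = -5`; `X² − a_7X + 7` root-free mod `p = 5`) for record `15390r1`. [folklore] -/
theorem card_c15390r1_7 :
    Nat.card (((⟨1, -1, 1, -4213103, -3327467913⟩ : WeierstrassCurve ℤ).map (Int.castRingHom (ZMod 7))).toAffine.Point) = 13 := by
  rw [@WeierstrassCurve.natCard_point_eq_one_add_card (ZMod 7) (@ZMod.instField 7 ⟨by norm_num⟩) _ _ _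
    (by decide +kernel), @card_sol_eq_sum_euler (ZMod 7) (@ZMod.instField 7 ⟨by norm_num⟩) _ _
    (by rw [ZMod.ringChar_zmod_n]; decide), ZMod.card]
  decide +kernel

/-- `#Ẽ(𝔽_13) = 14` (`a_13 = 0`; `X² − a_13X + 13` root-free mod `p = 5`) for record `15390u1`. [folklore] -/
theorem card_c15390u1_13 :
    Nat.card (((⟨1, -1, 1, -904277, 331209901⟩ : WeierstrassCurve ℤ).map (Int.castRingHom (ZMod 13))).toAffine.Point) = 14 := by
  rw [@WeierstrassCurve.natCard_point_eq_one_add_card (ZMod 13) (@ZMod.instField 13 ⟨by norm_num⟩) _ _ _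
    (by decide +kernel), @card_sol_eq_sum_euler (ZMod 13) (@ZMod.instField 13 ⟨by norm_num⟩) _ _
    (by rw [ZMod.ringChar_zmod_n]; decide), ZMod.card]
  decide +kernel

/-- `#Ẽ(𝔽_7) = 7` (`a_7 = 1`; `X² − a_7X + 7` root-free mod `p = 5`) for record `15390z1`. [folklore] -/
theorem card_c15390z1_7 :
    Nat.card (((⟨1, -1, 1, -9317, 529309⟩ : WeierstrassCurve ℤ).map (Int.castRingHom (ZMod 7))).toAffine.Point) = 7 := by
  rw [@WeierstrassCurve.natCard_point_eq_one_add_card (ZMod 7) (@ZMod.instField 7 ⟨by norm_num⟩) _ _ _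
    (by decide +kernel), @card_sol_eq_sum_euler (ZMod 7) (@ZMod.instField 7 ⟨by norm_num⟩) _ _
    (by rw [ZMod.ringChar_zmod_n]; decide), ZMod.card]
  decide +kernel

/-- `#Ẽ(𝔽_11) = 11` (`a_11 = 1`; `X² − a_11X + 11` root-free mod `p = 5`) for record `15640h1`. [folklore] -/
theorem card_c15640h1_11 :
    Nat.card (((⟨0, -1, 0, 11640, 87100⟩ : WeierstrassCurve ℤ).map (Int.castRingHom (ZMod 11))).toAffine.Point) = 11 := by
  rw [@WeierstrassCurve.natCard_point_eq_one_add_card (ZMod 11) (@ZMod.instField 11 ⟨by norm_num⟩) _ _ _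
    (by decide +kernel), @card_sol_eq_sum_euler (ZMod 11) (@ZMod.instField 11 ⟨by norm_num⟩) _ _
    (by rw [ZMod.ringChar_zmod_n]; decide), ZMod.card]
  decide +kernel

/-- `#Ẽ(𝔽_3) = 4` (`a_3 = 0`; `X² − a_3X + 3` root-free mod `p = 5`) for record `15730r1`. [folklore] -/
theorem card_c15730r1_3 :
    Nat.card (((⟨1, -1, 1, -1862818, 1134913981⟩ : WeierstrassCurve ℤ).map (Int.castRingHom (ZMod 3))).toAffine.Point) = 4 := by
  rw [@WeierstrassCurve.natCard_point_eq_one_add_card (ZMod 3) (@ZMod.instField 3 ⟨by norm_num⟩) _ _ _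
    (by decide +kernel), @card_sol_eq_sum_euler (ZMod 3) (@ZMod.instField 3 ⟨by norm_num⟩) _ _
    (by rw [ZMod.ringChar_zmod_n]; decide), ZMod.card]
  decide +kernel

/-- `#Ẽ(𝔽_7) = 13` (`a_7 = -5`; `X² − a_7X + 7` root-free mod `p = 5`) for record `15870y1`. [folklore] -/
theorem card_c15870y1_7 :
    Nat.card (((⟨1, 1, 1, 35485309, 126344805113⟩ : WeierstrassCurve ℤ).map (Int.castRingHom (ZMod 7))).toAffine.Point) = 13 := by
  rw [@WeierstrassCurve.natCard_point_eq_one_add_card (ZMod 7) (@ZMod.instField 7 ⟨by norm_num⟩) _ _ _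
    (by decide +kernel), @card_sol_eq_sum_euler (ZMod 7) (@ZMod.instField 7 ⟨by norm_num⟩) _ _
    (by rw [ZMod.ringChar_zmod_n]; decide), ZMod.card]
  decide +kernel

/-- `#Ẽ(𝔽_7) = 7` (`a_7 = 1`; `X² − a_7X + 7` root-free mod `p = 5`) for record `15930l1`. [folklore] -/
theorem card_c15930l1_7 :
    Nat.card (((⟨1, -1, 0, -1500, -3664⟩ : WeierstrassCurve ℤ).map (Int.castRingHom (ZMod 7))).toAffine.Point) = 7 := by
  rw [@WeierstrassCurve.natCard_point_eq_one_add_card (ZMod 7) (@ZMod.instField 7 ⟨by norm_num⟩) _ _ _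
    (by decide +kernel), @card_sol_eq_sum_euler (ZMod 7) (@ZMod.instField 7 ⟨by norm_num⟩) _ _
    (by rw [ZMod.ringChar_zmod_n]; decide), ZMod.card]
  decide +kernel

/-- `#Ẽ(𝔽_13) = 9` (`a_13 = 5`; `X² − a_13X + 13` root-free mod `p = 5`) for record `16065w1`. [folklore] -/
theorem card_c16065w1_13 :
    Nat.card (((⟨1, -1, 1, 1648, 16476⟩ : WeierstrassCurve ℤ).map (Int.castRingHom (ZMod 13))).toAffine.Point) = 9 := by
  rw [@WeierstrassCurve.natCard_point_eq_one_add_card (ZMod 13) (@ZMod.instField 13 ⟨by norm_num⟩) _ _ _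
    (by decide +kernel), @card_sol_eq_sum_euler (ZMod 13) (@ZMod.instField 13 ⟨by norm_num⟩) _ _
    (by rw [ZMod.ringChar_zmod_n]; decide), ZMod.card]
  decide +kernel

/-- `#Ẽ(𝔽_13) = 16` (`a_13 = -2`; `X² − a_13X + 13` root-free mod `p = 5`) for record `16080i1`. [folklore] -/
theorem card_c16080i1_13 :
    Nat.card (((⟨0, 1, 0, -13760, -100092⟩ : WeierstrassCurve ℤ).map (Int.castRingHom (ZMod 13))).toAffine.Point) = 16 := by
  rw [@WeierstrassCurve.natCard_point_eq_one_add_card (ZMod 13) (@ZMod.instField 13 ⟨by norm_num⟩) _ _ _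
    (by decide +kernel), @card_sol_eq_sum_euler (ZMod 13) (@ZMod.instField 13 ⟨by norm_num⟩) _ _
    (by rw [ZMod.ringChar_zmod_n]; decide), ZMod.card]
  decide +kernel

/-- `#Ẽ(𝔽_11) = 11` (`a_11 = 1`; `X² − a_11X + 11` root-free mod `p = 5`) for record `16110l1`. [folklore] -/
theorem card_c16110l1_11 :
    Nat.card (((⟨1, -1, 1, -113, -219⟩ : WeierstrassCurve ℤ).map (Int.castRingHom (ZMod 11))).toAffine.Point) = 11 := by
  rw [@WeierstrassCurve.natCard_point_eq_one_add_card (ZMod 11) (@ZMod.instField 11 ⟨by norm_num⟩) _ _ _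
    (by decide +kernel), @card_sol_eq_sum_euler (ZMod 11) (@ZMod.instField 11 ⟨by norm_num⟩) _ _
    (by rw [ZMod.ringChar_zmod_n]; decide), ZMod.card]
  decide +kernel

/-- `#Ẽ(𝔽_7) = 13` (`a_7 = -5`; `X² − a_7X + 7` root-free mod `p = 5`) for record `16320dd1`. [folklore] -/
theorem card_c16320dd1_7 :
    Nat.card (((⟨0, 1, 0, -345, 2655⟩ : WeierstrassCurve ℤ).map (Int.castRingHom (ZMod 7))).toAffine.Point) = 13 := by
  rw [@WeierstrassCurve.natCard_point_eq_one_add_card (ZMod 7) (@ZMod.instField 7 ⟨by norm_num⟩) _ _ _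
    (by decide +kernel), @card_sol_eq_sum_euler (ZMod 7) (@ZMod.instField 7 ⟨by norm_num⟩) _ _
    (by rw [ZMod.ringChar_zmod_n]; decide), ZMod.card]
  decide +kernel

/-- `#Ẽ(𝔽_11) = 16` (`a_11 = -4`; `X² − a_11X + 11` root-free mod `p = 5`) for record `16560cf1`. [folklore] -/
theorem card_c16560cf1_11 :
    Nat.card (((⟨0, 0, 0, -192, 2864⟩ : WeierstrassCurve ℤ).map (Int.castRingHom (ZMod 11))).toAffine.Point) = 16 := by
  rw [@WeierstrassCurve.natCard_point_eq_one_add_card (ZMod 11) (@ZMod.instField 11 ⟨by norm_num⟩) _ _ _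
    (by decide +kernel), @card_sol_eq_sum_euler (ZMod 11) (@ZMod.instField 11 ⟨by norm_num⟩) _ _
    (by rw [ZMod.ringChar_zmod_n]; decide), ZMod.card]
  decide +kernel

/-- `#Ẽ(𝔽_7) = 3` (`a_7 = 5`; `X² − a_7X + 7` root-free mod `p = 5`) for record `16680b1`. [folklore] -/
theorem card_c16680b1_7 :
    Nat.card (((⟨0, -1, 0, 40, 12⟩ : WeierstrassCurve ℤ).map (Int.castRingHom (ZMod 7))).toAffine.Point) = 3 := by
  rw [@WeierstrassCurve.natCard_point_eq_one_add_card (ZMod 7) (@ZMod.instField 7 ⟨by norm_num⟩) _ _ _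
    (by decide +kernel), @card_sol_eq_sum_euler (ZMod 7) (@ZMod.instField 7 ⟨by norm_num⟩) _ _
    (by rw [ZMod.ringChar_zmod_n]; decide), ZMod.card]
  decide +kernel

/-- `#Ẽ(𝔽_7) = 8` (`a_7 = 0`; `X² − a_7X + 7` root-free mod `p = 5`) for record `16830cr1`. [folklore] -/
theorem card_c16830cr1_7 :
    Nat.card (((⟨1, -1, 1, -331517, 73553221⟩ : WeierstrassCurve ℤ).map (Int.castRingHom (ZMod 7))).toAffine.Point) = 8 := by
  rw [@WeierstrassCurve.natCard_point_eq_one_add_card (ZMod 7) (@ZMod.instField 7 ⟨by norm_num⟩) _ _ _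
    (by decide +kernel), @card_sol_eq_sum_euler (ZMod 7) (@ZMod.instField 7 ⟨by norm_num⟩) _ _
    (by rw [ZMod.ringChar_zmod_n]; decide), ZMod.card]
  decide +kernel

/-- `#Ẽ(𝔽_7) = 8` (`a_7 = 0`; `X² − a_7X + 7` root-free mod `p = 5`) for record `16830ct1`. [folklore] -/
theorem card_c16830ct1_7 :
    Nat.card (((⟨1, -1, 1, 4813, 24211⟩ : WeierstrassCurve ℤ).map (Int.castRingHom (ZMod 7))).toAffine.Point) = 8 := by
  rw [@WeierstrassCurve.natCard_point_eq_one_add_card (ZMod 7) (@ZMod.instField 7 ⟨by norm_num⟩) _ _ _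
    (by decide +kernel), @card_sol_eq_sum_euler (ZMod 7) (@ZMod.instField 7 ⟨by norm_num⟩) _ _
    (by rw [ZMod.ringChar_zmod_n]; decide), ZMod.card]
  decide +kernel

/-- `#Ẽ(𝔽_13) = 14` (`a_13 = 0`; `X² − a_13X + 13` root-free mod `p = 5`) for record `16905bb1`. [folklore] -/
theorem card_c16905bb1_13 :
    Nat.card (((⟨0, 1, 1, -4833915, -5051688631⟩ : WeierstrassCurve ℤ).map (Int.castRingHom (ZMod 13))).toAffine.Point) = 14 := by
  rw [@WeierstrassCurve.natCard_point_eq_one_add_card (ZMod 13) (@ZMod.instField 13 ⟨by norm_num⟩) _ _ _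
    (by decide +kernel), @card_sol_eq_sum_euler (ZMod 13) (@ZMod.instField 13 ⟨by norm_num⟩) _ _
    (by rw [ZMod.ringChar_zmod_n]; decide), ZMod.card]
  decide +kernel

/-- `#Ẽ(𝔽_3) = 7` (`a_3 = -3`; `X² − a_3X + 3` root-free mod `p = 5`) for record `17360bo1`. [folklore] -/
theorem card_c17360bo1_3 :
    Nat.card (((⟨0, 0, 0, -13312, 597616⟩ : WeierstrassCurve ℤ).map (Int.castRingHom (ZMod 3))).toAffine.Point) = 7 := by
  rw [@WeierstrassCurve.natCard_point_eq_one_add_card (ZMod 3) (@ZMod.instField 3 ⟨by norm_num⟩) _ _ _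
    (by decide +kernel), @card_sol_eq_sum_euler (ZMod 3) (@ZMod.instField 3 ⟨by norm_num⟩) _ _
    (by rw [ZMod.ringChar_zmod_n]; decide), ZMod.card]
  decide +kernel

/-- `#Ẽ(𝔽_5) = 8` (`a_5 = -2`; `X² − a_5X + 5` root-free mod `p = 7`) for record `17388a1`. [folklore] -/
theorem card_c17388a1_5 :
    Nat.card (((⟨0, 0, 0, -216, 1269⟩ : WeierstrassCurve ℤ).map (Int.castRingHom (ZMod 5))).toAffine.Point) = 8 := by
  rw [@WeierstrassCurve.natCard_point_eq_one_add_card (ZMod 5) (@ZMod.instField 5 ⟨by norm_num⟩) _ _ _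
    (by decide +kernel), @card_sol_eq_sum_euler (ZMod 5) (@ZMod.instField 5 ⟨by norm_num⟩) _ _
    (by rw [ZMod.ringChar_zmod_n]; decide), ZMod.card]
  decide +kernel

/-- `#Ẽ(𝔽_11) = 18` (`a_11 = -6`; `X² − a_11X + 11` root-free mod `p = 5`) for record `17520a1`. [folklore] -/
theorem card_c17520a1_11 :
    Nat.card (((⟨0, -1, 0, 3544, 732240⟩ : WeierstrassCurve ℤ).map (Int.castRingHom (ZMod 11))).toAffine.Point) = 18 := by
  rw [@WeierstrassCurve.natCard_point_eq_one_add_card (ZMod 11) (@ZMod.instField 11 ⟨by norm_num⟩) _ _ _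
    (by decide +kernel), @card_sol_eq_sum_euler (ZMod 11) (@ZMod.instField 11 ⟨by norm_num⟩) _ _
    (by rw [ZMod.ringChar_zmod_n]; decide), ZMod.card]
  decide +kernel

/-- `#Ẽ(𝔽_23) = 26` (`a_23 = -2`; `X² − a_23X + 23` root-free mod `p = 7`) for record `17556e1`. [folklore] -/
theorem card_c17556e1_23 :
    Nat.card (((⟨0, -1, 0, -83181, -5513463⟩ : WeierstrassCurve ℤ).map (Int.castRingHom (ZMod 23))).toAffine.Point) = 26 := by
  rw [@WeierstrassCurve.natCard_point_eq_one_add_card (ZMod 23) (@ZMod.instField 23 ⟨by norm_num⟩) _ _ _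
    (by decide +kernel), @card_sol_eq_sum_euler (ZMod 23) (@ZMod.instField 23 ⟨by norm_num⟩) _ _
    (by rw [ZMod.ringChar_zmod_n]; decide), ZMod.card]
  decide +kernel

/-- `#Ẽ(𝔽_31) = 31` (`a_31 = 1`; `X² − a_31X + 31` root-free mod `p = 5`) for record `17745j1`. [folklore] -/
theorem card_c17745j1_31 :
    Nat.card (((⟨1, 1, 1, -335, -8338⟩ : WeierstrassCurve ℤ).map (Int.castRingHom (ZMod 31))).toAffine.Point) = 31 := by
  rw [@WeierstrassCurve.natCard_point_eq_one_add_card (ZMod 31) (@ZMod.instField 31 ⟨by norm_num⟩) _ _ _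
    (by decide +kernel), @card_sol_eq_sum_euler (ZMod 31) (@ZMod.instField 31 ⟨by norm_num⟩) _ _
    (by rw [ZMod.ringChar_zmod_n]; decide), ZMod.card]
  decide +kernel

/-- `#Ẽ(𝔽_7) = 13` (`a_7 = -5`; `X² − a_7X + 7` root-free mod `p = 5`) for record `17760b1`. [folklore] -/
theorem card_c17760b1_7 :
    Nat.card (((⟨0, -1, 0, 41681064, 51993672840⟩ : WeierstrassCurve ℤ).map (Int.castRingHom (ZMod 7))).toAffine.Point) = 13 := by
  rw [@WeierstrassCurve.natCard_point_eq_one_add_card (ZMod 7) (@ZMod.instField 7 ⟨by norm_num⟩) _ _ _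
    (by decide +kernel), @card_sol_eq_sum_euler (ZMod 7) (@ZMod.instField 7 ⟨by norm_num⟩) _ _
    (by rw [ZMod.ringChar_zmod_n]; decide), ZMod.card]
  decide +kernel

/-- `#Ẽ(𝔽_7) = 8` (`a_7 = 0`; `X² − a_7X + 7` root-free mod `p = 5`) for record `17880o1`. [folklore] -/
theorem card_c17880o1_7 :
    Nat.card (((⟨0, 1, 0, 735, -2637⟩ : WeierstrassCurve ℤ).map (Int.castRingHom (ZMod 7))).toAffine.Point) = 8 := by
  rw [@WeierstrassCurve.natCard_point_eq_one_add_card (ZMod 7) (@ZMod.instField 7 ⟨by norm_num⟩) _ _ _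
    (by decide +kernel), @card_sol_eq_sum_euler (ZMod 7) (@ZMod.instField 7 ⟨by norm_num⟩) _ _
    (by rw [ZMod.ringChar_zmod_n]; decide), ZMod.card]
  decide +kernel

/-- `#Ẽ(𝔽_7) = 3` (`a_7 = 5`; `X² − a_7X + 7` root-free mod `p = 5`) for record `17940b1`. [folklore] -/
theorem card_c17940b1_7 :
    Nat.card (((⟨0, -1, 0, -156, 936⟩ : WeierstrassCurve ℤ).map (Int.castRingHom (ZMod 7))).toAffine.Point) = 3 := by
  rw [@WeierstrassCurve.natCard_point_eq_one_add_card (ZMod 7) (@ZMod.instField 7 ⟨by norm_num⟩) _ _ _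
    (by decide +kernel), @card_sol_eq_sum_euler (ZMod 7) (@ZMod.instField 7 ⟨by norm_num⟩) _ _
    (by rw [ZMod.ringChar_zmod_n]; decide), ZMod.card]
  decide +kernel

/-- `#Ẽ(𝔽_29) = 27` (`a_29 = 3`; `X² − a_29X + 29` root-free mod `p = 7`) for record `17955m1`. [folklore] -/
theorem card_c17955m1_29 :
    Nat.card (((⟨0, 0, 1, 177363, -146444578⟩ : WeierstrassCurve ℤ).map (Int.castRingHom (ZMod 29))).toAffine.Point) = 27 := by
  rw [@WeierstrassCurve.natCard_point_eq_one_add_card (ZMod 29) (@ZMod.instField 29 ⟨by norm_num⟩) _ _ _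
    (by decide +kernel), @card_sol_eq_sum_euler (ZMod 29) (@ZMod.instField 29 ⟨by norm_num⟩) _ _
    (by rw [ZMod.ringChar_zmod_n]; decide), ZMod.card]
  decide +kernel

/-- `#Ẽ(𝔽_11) = 8` (`a_11 = 4`; `X² − a_11X + 11` root-free mod `p = 5`) for record `17955u1`. [folklore] -/
theorem card_c17955u1_11 :
    Nat.card (((⟨0, 0, 1, 19707, 5423873⟩ : WeierstrassCurve ℤ).map (Int.castRingHom (ZMod 11))).toAffine.Point) = 8 := by
  rw [@WeierstrassCurve.natCard_point_eq_one_add_card (ZMod 11) (@ZMod.instField 11 ⟨by norm_num⟩) _ _ _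
    (by decide +kernel), @card_sol_eq_sum_euler (ZMod 11) (@ZMod.instField 11 ⟨by norm_num⟩) _ _
    (by rw [ZMod.ringChar_zmod_n]; decide), ZMod.card]
  decide +kernel

/-- `#Ẽ(𝔽_7) = 8` (`a_7 = 0`; `X² − a_7X + 7` root-free mod `p = 5`) for record `18360a1`. [folklore] -/
theorem card_c18360a1_7 :
    Nat.card (((⟨0, 0, 0, -567108, 291964932⟩ : WeierstrassCurve ℤ).map (Int.castRingHom (ZMod 7))).toAffine.Point) = 8 := by
  rw [@WeierstrassCurve.natCard_point_eq_one_add_card (ZMod 7) (@ZMod.instField 7 ⟨by norm_num⟩) _ _ _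
    (by decide +kernel), @card_sol_eq_sum_euler (ZMod 7) (@ZMod.instField 7 ⟨by norm_num⟩) _ _
    (by rw [ZMod.ringChar_zmod_n]; decide), ZMod.card]
  decide +kernel

/-- `#Ẽ(𝔽_3) = 7` (`a_3 = -3`; `X² − a_3X + 3` root-free mod `p = 5`) for record `18590d1`. [folklore] -/
theorem card_c18590d1_3 :
    Nat.card (((⟨1, -1, 0, -516580, 291269200⟩ : WeierstrassCurve ℤ).map (Int.castRingHom (ZMod 3))).toAffine.Point) = 7 := by
  rw [@WeierstrassCurve.natCard_point_eq_one_add_card (ZMod 3) (@ZMod.instField 3 ⟨by norm_num⟩) _ _ _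
    (by decide +kernel), @card_sol_eq_sum_euler (ZMod 3) (@ZMod.instField 3 ⟨by norm_num⟩) _ _
    (by rw [ZMod.ringChar_zmod_n]; decide), ZMod.card]
  decide +kernel

/-- `#Ẽ(𝔽_7) = 9` (`a_7 = -1`; `X² − a_7X + 7` root-free mod `p = 5`) for record `18590j1`. [folklore] -/
theorem card_c18590j1_7 :
    Nat.card (((⟨1, 1, 0, -158187, 24152029⟩ : WeierstrassCurve ℤ).map (Int.castRingHom (ZMod 7))).toAffine.Point) = 9 := by
  rw [@WeierstrassCurve.natCard_point_eq_one_add_card (ZMod 7) (@ZMod.instField 7 ⟨by norm_num⟩) _ _ _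
    (by decide +kernel), @card_sol_eq_sum_euler (ZMod 7) (@ZMod.instField 7 ⟨by norm_num⟩) _ _
    (by rw [ZMod.ringChar_zmod_n]; decide), ZMod.card]
  decide +kernel

/-- `#Ẽ(𝔽_7) = 8` (`a_7 = 0`; `X² − a_7X + 7` root-free mod `p = 5`) for record `18720bq1`. [folklore] -/
theorem card_c18720bq1_7 :
    Nat.card (((⟨0, 0, 0, -14414817, 21063537376⟩ : WeierstrassCurve ℤ).map (Int.castRingHom (ZMod 7))).toAffine.Point) = 8 := by
  rw [@WeierstrassCurve.natCard_point_eq_one_add_card (ZMod 7) (@ZMod.instField 7 ⟨by norm_num⟩) _ _ _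
    (by decide +kernel), @card_sol_eq_sum_euler (ZMod 7) (@ZMod.instField 7 ⟨by norm_num⟩) _ _
    (by rw [ZMod.ringChar_zmod_n]; decide), ZMod.card]
  decide +kernel

/-- `#Ẽ(𝔽_23) = 22` (`a_23 = 2`; `X² − a_23X + 23` root-free mod `p = 7`) for record `18774bd1`. [folklore] -/
theorem card_c18774bd1_23 :
    Nat.card (((⟨1, -1, 1, -7592, 552683⟩ : WeierstrassCurve ℤ).map (Int.castRingHom (ZMod 23))).toAffine.Point) = 22 := by
  rw [@WeierstrassCurve.natCard_point_eq_one_add_card (ZMod 23) (@ZMod.instField 23 ⟨by norm_num⟩) _ _ _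
    (by decide +kernel), @card_sol_eq_sum_euler (ZMod 23) (@ZMod.instField 23 ⟨by norm_num⟩) _ _
    (by rw [ZMod.ringChar_zmod_n]; decide), ZMod.card]
  decide +kernel

/-- `#Ẽ(𝔽_13) = 9` (`a_13 = 5`; `X² − a_13X + 13` root-free mod `p = 5`) for record `19170s1`. [folklore] -/
theorem card_c19170s1_13 :
    Nat.card (((⟨1, -1, 1, -105383, 13215711⟩ : WeierstrassCurve ℤ).map (Int.castRingHom (ZMod 13))).toAffine.Point) = 9 := by
  rw [@WeierstrassCurve.natCard_point_eq_one_add_card (ZMod 13) (@ZMod.instField 13 ⟨by norm_num⟩) _ _ _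
    (by decide +kernel), @card_sol_eq_sum_euler (ZMod 13) (@ZMod.instField 13 ⟨by norm_num⟩) _ _
    (by rw [ZMod.ringChar_zmod_n]; decide), ZMod.card]
  decide +kernel

/-- `#Ẽ(𝔽_13) = 17` (`a_13 = -3`; `X² − a_13X + 13` root-free mod `p = 5`) for record `19170u1`. [folklore] -/
theorem card_c19170u1_13 :
    Nat.card (((⟨1, -1, 1, -1703, -32669⟩ : WeierstrassCurve ℤ).map (Int.castRingHom (ZMod 13))).toAffine.Point) = 17 := by
  rw [@WeierstrassCurve.natCard_point_eq_one_add_card (ZMod 13) (@ZMod.instField 13 ⟨by norm_num⟩) _ _ _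
    (by decide +kernel), @card_sol_eq_sum_euler (ZMod 13) (@ZMod.instField 13 ⟨by norm_num⟩) _ _
    (by rw [ZMod.ringChar_zmod_n]; decide), ZMod.card]
  decide +kernel

/-- `#Ẽ(𝔽_7) = 9` (`a_7 = -1`; `X² − a_7X + 7` root-free mod `p = 23`) for record `19665m1`. [folklore] -/
theorem card_c19665m1_7 :
    Nat.card (((⟨0, 0, 1, -303623797278, 64394958626028058⟩ : WeierstrassCurve ℤ).map (Int.castRingHom (ZMod 7))).toAffine.Point) = 9 := by
  rw [@WeierstrassCurve.natCard_point_eq_one_add_card (ZMod 7) (@ZMod.instField 7 ⟨by norm_num⟩) _ _ _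
    (by decide +kernel), @card_sol_eq_sum_euler (ZMod 7) (@ZMod.instField 7 ⟨by norm_num⟩) _ _
    (by rw [ZMod.ringChar_zmod_n]; decide), ZMod.card]
  decide +kernel

/-- `#Ẽ(𝔽_11) = 11` (`a_11 = 1`; `X² − a_11X + 11` root-free mod `p = 5`) for record `19890o1`. [folklore] -/
theorem card_c19890o1_11 :
    Nat.card (((⟨1, -1, 0, -37449, -6933875⟩ : WeierstrassCurve ℤ).map (Int.castRingHom (ZMod 11))).toAffine.Point) = 11 := by
  rw [@WeierstrassCurve.natCard_point_eq_one_add_card (ZMod 11) (@ZMod.instField 11 ⟨by norm_num⟩) _ _ _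
    (by decide +kernel), @card_sol_eq_sum_euler (ZMod 11) (@ZMod.instField 11 ⟨by norm_num⟩) _ _
    (by rw [ZMod.ringChar_zmod_n]; decide), ZMod.card]
  decide +kernel

end Summit.BirchSwinnertonDyer.BirchSwinnertonDyer.Rank1Residual.X11RankOne
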